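import Literature.Computability.Complexity.MurrayWilliams2018MachineB
import HarnessLib

/-!
# Murray–Williams 2018, Thm. 1.2 at the exponential level, I: Williams' generator `A` (Lemma 3.1)
# at QUASI-POLYNOMIAL size

C. D. Murray, R. R. Williams, *Circuit lower bounds for nondeterministic quasi-polytime: an easy
witness lemma for NP and NQP*, STOC 2018, Thm. 1.2 for the classes `AC⁰[m]`
(`MurrayWilliams2018_thm_1_2_acc`, `MurrayWilliams2018.lean`). The assembly
`MurrayWilliams2018_thm_1_2_acc_of_EWL_of_expSimulationAllDepths`
(`MurrayWilliams2018ExpLevelAllDepths.lean`) reduces the theorem to the easy witness lemma and ONE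
machine construction, the *exponential-level simulation* `hN'`: under `AC⁰[m]`-SAT algorithms for
`2^{⌊w^{1/r}⌋}`-size circuits in time `2^{w - ⌊w^{1/r}⌋}` at every depth (`AccSatSubexp`) and
QUASI-POLYNOMIAL-size depth-`d` `AC⁰[m]` circuits for `P`
(`P ⊆ ⋃ₐ DepthSizeClass (accBasis m) d (a · 2^{(log₂ n)^k} + a)`, assumption (A) of the printed
proof of Thm. 1.2, §5), every `L ∈ NTIME(2ⁿ)` with subexponential witness circuits lies in
`NTIME(n + 2ⁿ/n)`. As explained in `MurrayWilliams2018Headline.lean`, discharging `hN'` means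
re-running BOTH halves of Williams' Theorem 3.2 (J. ACM 2014): the generator `A` of Lemma 3.1, at
quasi-polynomial instead of polynomial size, and the machine `B`.

This file re-runs the FIRST half. Williams 2014, Lemma 3.1 (pp. 10–12): "Assume `P` has `ACC`
circuits of depth `d'` and size at most `S(n)` … there is a nondeterministic algorithm `A` … either
prints reject or it prints an `ACC` circuit `C'ₓ` … equivalent to `Cₓ`"; the printed `S` is an
arbitrary (constructible) size function, and the proof of Thm. 1.2 of Murray–Williams runs it at
`S(n) = 2^{log^{O(1)} n}` ("`C`-circuits of size `2^{O(log^{k} n)}`", §5, step (A)). The tree's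
polynomial `A` (`Williams2014MachineA.lean`, `Williams2014StageAFP.lean`,
`Williams2014_lemma_3_1_holds`) is reused stage by stage:

* `MachineAQ.QPBdd` — the bookkeeping class of quasi-polynomially bounded functions
  (`f n ≤ 2^{P(size n)}`), closed under the arithmetic of the machine, eventually below every
  `2^{⌊n^{1/r}⌋}` (`eventually_le_two_pow_nthRoot`) and `O(n + 2ⁿ/n)` (`le_williamsBound`);
* `Tableau.exists_tableauCircuits_accQ`, `MachineAQ.exists_goodFamiliesQ` — the intended tableau
  circuits of the clause-bit machine under the QUASI-POLYNOMIAL hypothesis (the proofs of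
  `exists_tableauCircuits_acc`, `exists_goodFamilies` with the size polynomial replaced by
  `2^{P₀(size n)}`);
* the stage function of `A` is Williams' `stageA` with the size bound instantiated PER INPUT LENGTH,
  `stageA c m M pT dE (C (S n))`, `S n = 2^{P₀(size n)}`, so that its soundness and completeness
  glue (`stageA_sound`, `stageA_complete`, `blocksA_class`, `dnfCircuit_class`) apply verbatim;
  `MachineAQ.exists_stageAQFn` is its `FP` implementation (the proof of `exists_stageAFn` with the
  numeral `qE(n)` replaced by the numeral `2^{P₀(size n)}`, computed in unary,
  `MachineAQ.twoPowPolySize_code`);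
* **`MachineAQ.generatorQ`** — the machine `A` at quasi-polynomial size: the clause circuits are
  nondeterministically generated in time `O(n + 2ⁿ/n)`, some guess being accepted on ALL LONG INPUTS
  (`NGeneratesFrom N₀ williamsBound (GoodClauseCircuitsB …)`; accepted printouts are good on every
  input): the `AC⁰[m]`-SAT algorithm of `AccSatSubexp` is specified on `2^{⌊w^{1/r}⌋}`-size instances
  only, a class that contains the quasi-polynomial-size instance VALUE for `w` large but not for `w`
  small, so `A` rejects short inputs without the SAT call (flag wrapper `flagAux`,
  `NSUBEXPGuardedBall.lean`) — harmless for the machine `B`, which patches finitely many input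
  lengths anyway (`mem_NTIME_of_eqOn`).

Everything is proved; no named fact is introduced (D-0026).

## References

* C. D. Murray, R. R. Williams, *Circuit lower bounds for nondeterministic quasi-polytime: an easy
  witness lemma for NP and NQP*, Proc. 50th STOC (2018) 890–901, Thm. 1.2 and its proof (§5)
  [MurrayWilliams2018].
* R. Williams, *Nonuniform ACC circuit lower bounds*, J. ACM 61(1) (2014) 2:1–2:32, Lemma 3.1 and
  its proof (pp. 10–12), Lemma 5.1 [Williams2014].
* S. Arora, B. Barak, *Computational Complexity: A Modern Approach*, CUP 2009, §1.3, §2.1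
  (machines, clocks, verifiers) [AroraBarakCC2009].
-/

noncomputable section

namespace Literature.Computability.Complexity

open _root_.Computability Turing Polynomial

/-! ### Quasi-polynomially bounded functions -/

namespace MachineAQ

/-- `f` is QUASI-POLYNOMIALLY bounded: `f n ≤ 2 ^ P(size n)` for a polynomial `P`
(`Nat.size n = ⌊log₂ n⌋ + 1` for `n ≥ 1`). [folklore] -/
def QPBdd (f : ℕ → ℕ) : Prop := ∃ P : Polynomial ℕ, ∀ n, f n ≤ 2 ^ P.eval (Nat.size n)

namespace QPBdd

variable {f g : ℕ → ℕ}

/-- Constants. [folklore] -/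
theorem const (k : ℕ) : QPBdd fun _ => k :=
  ⟨Polynomial.C k, fun n => by simpa using (Nat.lt_two_pow_self (n := k)).le⟩

/-- The identity (`n < 2^{size n}`). [folklore] -/
theorem id : QPBdd fun n => n := ⟨X, fun n => by simpa using (Nat.lt_size_self n).le⟩

/-- Domination. [folklore] -/
theorem of_le (hg : QPBdd g) (h : ∀ n, f n ≤ g n) : QPBdd f := by
  obtain ⟨P, hP⟩ := hg; exact ⟨P, fun n => (h n).trans (hP n)⟩

/-- Sums. [folklore] -/
theorem add (hf : QPBdd f) (hg : QPBdd g) : QPBdd fun n => f n + g n := by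
  obtain ⟨P, hP⟩ := hf; obtain ⟨Q, hQ⟩ := hg
  refine ⟨P + Q + 1, fun n => ?_⟩
  have h1 := hP n
  have h2 := hQ n
  have h3 : 2 ^ P.eval n.size ≤ 2 ^ (P.eval n.size + Q.eval n.size) :=
    Nat.pow_le_pow_right two_pos (Nat.le_add_right _ _)
  have h4 : 2 ^ Q.eval n.size ≤ 2 ^ (P.eval n.size + Q.eval n.size) :=
    Nat.pow_le_pow_right two_pos (Nat.le_add_left _ _)
  show f n + g n ≤ _
  rw [eval_add, eval_add, eval_one, pow_succ]
  omega

/-- Products. [folklore] -/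
theorem mul (hf : QPBdd f) (hg : QPBdd g) : QPBdd fun n => f n * g n := by
  obtain ⟨P, hP⟩ := hf; obtain ⟨Q, hQ⟩ := hg
  exact ⟨P + Q, fun n => by rw [eval_add, pow_add]; exact Nat.mul_le_mul (hP n) (hQ n)⟩

/-- `a · 2ʸ + a ≤ 2^{y + a}`. [folklore] -/
theorem mul_two_pow_add_le (a y : ℕ) : a * 2 ^ y + a ≤ 2 ^ (y + a) := by
  rcases Nat.eq_zero_or_pos a with rfl | ha
  · simp
  · have h1 : a ≤ 2 ^ (a - 1) := by
      have := Nat.lt_two_pow_self (n := a - 1); omega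
    have h2 : 2 ^ (y + a) = 2 ^ y * (2 * 2 ^ (a - 1)) := by
      rw [pow_add, ← pow_succ']
      congr 2
      omega
    rw [h2]
    nlinarith [Nat.one_le_two_pow (n := y)]

/-- Post-composition with a polynomial. [folklore] -/
theorem comp (hf : QPBdd f) (q : Polynomial ℕ) : QPBdd fun n => q.eval (f n) := by
  obtain ⟨P, hP⟩ := hf
  obtain ⟨c, k, hck⟩ := exists_eval_le_mul_pow_add q
  refine ⟨Polynomial.C k * P + Polynomial.C c, fun n => ?_⟩
  have h2 : (f n) ^ k ≤ 2 ^ (k * P.eval n.size) := by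
    rw [pow_mul']; exact Nat.pow_le_pow_left (hP n) k
  calc q.eval (f n) ≤ c * (f n) ^ k + c := hck _
    _ ≤ c * 2 ^ (k * P.eval n.size) + c := by gcongr
    _ ≤ 2 ^ (k * P.eval n.size + c) := mul_two_pow_add_le _ _
    _ = 2 ^ (Polynomial.C k * P + Polynomial.C c).eval n.size := by simp

/-- Polynomials are quasi-polynomially bounded. [folklore] -/
theorem poly (p : Polynomial ℕ) : QPBdd fun n => p.eval n := QPBdd.id.comp p

/-- Polynomially bounded functions are quasi-polynomially bounded. [folklore] -/
theorem of_polyBdd (hf : MachineA.PolyBdd f) : QPBdd f := by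
  obtain ⟨p, hp⟩ := hf; exact (poly p).of_le hp

/-- The size bound `2^{P(size n)}` itself. [folklore] -/
theorem twoPow (P : Polynomial ℕ) : QPBdd fun n => 2 ^ P.eval (Nat.size n) := ⟨P, fun _ => le_rfl⟩

/-- `size n ≤ log₂ (n + 1) + 1`. [folklore] -/
theorem size_le_log_succ (n : ℕ) : Nat.size n ≤ Nat.log 2 (n + 1) + 1 :=
  Nat.size_le.2 ((Nat.lt_succ_self n).trans (Nat.lt_pow_succ_log_self one_lt_two _))

/-- **A polynomial in `size n` is eventually below every root `⌊n^{1/r}⌋`.** [folklore] -/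
theorem eventually_poly_size_le_nthRoot (P : Polynomial ℕ) {r : ℕ} (hr : r ≠ 0) :
    ∃ N₀ : ℕ, ∀ n : ℕ, N₀ ≤ n → P.eval (Nat.size n) ≤ Nat.nthRoot r n := by
  obtain ⟨c, k, hk0, hck⟩ := exists_eval_le_mul_pow_add_pos P
  have hrk : r * k ≠ 0 := Nat.mul_ne_zero hr hk0
  obtain ⟨N, hN⟩ := eventually_log_le_nthRoot (c + 1) (2 * (c + 1)) hrk
  refine ⟨N, fun n hn => ?_⟩
  set s := Nat.size n with hs
  set ρ := Nat.nthRoot (r * k) n with hρ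
  have h1 : (c + 1) * (s + 1) ≤ ρ := by
    have := hN n hn
    have hsz := size_le_log_succ n
    have : (c + 1) * (s + 1) ≤ (c + 1) * (Nat.log 2 (n + 1) + 2) := Nat.mul_le_mul_left _ (by omega)
    nlinarith
  have h2 : c * s ^ k + c ≤ ((c + 1) * (s + 1)) ^ k := by
    have hsk : s ^ k + 1 ≤ (s + 1) ^ k := by
      have := Nat.pow_le_pow_left (Nat.le_succ s) k
      rcases Nat.eq_zero_or_pos (s) with h0 | hpos
      · rw [h0, zero_pow hk0]; simp
      · -- `s^k < (s+1)^k`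
        have := Nat.pow_lt_pow_left (Nat.lt_add_one s) hk0
        omega
    have hc1 : c + 1 ≤ (c + 1) ^ k := by
      calc c + 1 = (c + 1) ^ 1 := (pow_one _).symm
        _ ≤ (c + 1) ^ k := Nat.pow_le_pow_right (Nat.succ_pos c) (Nat.one_le_iff_ne_zero.2 hk0)
    calc c * s ^ k + c ≤ (c + 1) * (s ^ k + 1) := by
          have : (c + 1) * (s ^ k + 1) = c * s ^ k + c + s ^ k + 1 := by ring
          omega
      _ ≤ (c + 1) * (s + 1) ^ k := Nat.mul_le_mul_left _ hsk
      _ ≤ (c + 1) ^ k * (s + 1) ^ k := Nat.mul_le_mul_right _ hc1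
      _ = ((c + 1) * (s + 1)) ^ k := (mul_pow _ _ _).symm
  have h3 : ((c + 1) * (s + 1)) ^ k ≤ ρ ^ k := Nat.pow_le_pow_left h1 k
  have h4 : ρ ^ k ≤ Nat.nthRoot r n := by
    rw [Nat.le_nthRoot_iff hr, ← pow_mul, mul_comm k r]
    exact Nat.pow_nthRoot_le (Or.inl hrk)
  exact (hck s).trans (h2.trans (h3.trans h4))

/-- **A quasi-polynomially bounded function is eventually below `2^{⌊n^{1/r}⌋}`** (`r ≠ 0`).
[folklore] -/
theorem eventually_le_two_pow_nthRoot (hf : QPBdd f) {r : ℕ} (hr : r ≠ 0) :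
    ∃ N₀ : ℕ, ∀ n : ℕ, N₀ ≤ n → f n ≤ 2 ^ Nat.nthRoot r n := by
  obtain ⟨P, hP⟩ := hf
  obtain ⟨N₀, hN₀⟩ := eventually_poly_size_le_nthRoot P hr
  exact ⟨N₀, fun n hn => (hP n).trans (Nat.pow_le_pow_right two_pos (hN₀ n hn))⟩

/-- Quasi-polynomially bounded functions are monotonically dominated: `f n ≤ F N` for `n ≤ N`
with `F N = 2^{P(size N)}`. [folklore] -/
theorem exists_mono_bound (hf : QPBdd f) :
    ∃ F : ℕ → ℕ, Monotone F ∧ ∀ n, f n ≤ F n := by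
  obtain ⟨P, hP⟩ := hf
  refine ⟨fun n => 2 ^ P.eval (Nat.size n), fun a b hab => ?_, hP⟩
  exact Nat.pow_le_pow_right two_pos (natPoly_eval_mono P (Nat.size_le_size hab))

/-- **A quasi-polynomially bounded function is `O(n + 2ⁿ/n)`.** [folklore] -/
theorem le_williamsBound (hf : QPBdd f) : ∃ C, ∀ n, f n ≤ C * williamsBound n + C := by
  obtain ⟨N₀, hN₀⟩ := hf.eventually_le_two_pow_nthRoot (r := 2) two_ne_zero
  obtain ⟨K, hK⟩ := exists_two_pow_nthRoot_le_williamsBound (r := 2) le_rfl 1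
  obtain ⟨F, hFm, hF⟩ := hf.exists_mono_bound
  refine ⟨K + F N₀, fun n => ?_⟩
  rcases le_or_gt N₀ n with hn | hn
  · calc f n ≤ 2 ^ Nat.nthRoot 2 n := hN₀ n hn
      _ ≤ 2 ^ (1 * Nat.nthRoot 2 n + 1) := Nat.pow_le_pow_right two_pos (by omega)
      _ ≤ K * williamsBound n + K := hK n
      _ ≤ (K + F N₀) * williamsBound n + (K + F N₀) := by rw [Nat.add_mul]; omega
  · calc f n ≤ F n := hF n
      _ ≤ F N₀ := hFm hn.le
      _ ≤ (K + F N₀) * williamsBound n + (K + F N₀) := by omega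

/-- `log₂` of a quasi-polynomially bounded function is polynomial in `size n`. [folklore] -/
theorem exists_log_le (hf : QPBdd f) : ∃ P : Polynomial ℕ, ∀ n, Nat.log 2 (f n) ≤ P.eval (Nat.size n) := by
  obtain ⟨P, hP⟩ := hf
  refine ⟨P, fun n => ?_⟩
  calc Nat.log 2 (f n) ≤ Nat.log 2 (2 ^ P.eval n.size) := Nat.log_mono_right (hP n)
    _ = P.eval n.size := Nat.log_pow one_lt_two _

/-- **Quasi-polynomial circuit sizes at polynomially related lengths are quasi-polynomial**: for a
quasi-polynomially bounded argument `g`, `a · 2^{(log₂ (g n))^k} + a + 2 ≤ 2^{P₀(size n)}` for one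
polynomial `P₀`. [folklore] -/
theorem exists_accSize_le (a k : ℕ) (hg : QPBdd g) :
    ∃ P₀ : Polynomial ℕ, ∀ n, a * 2 ^ Nat.log 2 (g n) ^ k + a + 2 ≤ 2 ^ P₀.eval (Nat.size n) := by
  obtain ⟨P, hP⟩ := hg.exists_log_le
  refine ⟨P ^ k + Polynomial.C (a + 2), fun n => ?_⟩
  have h1 : 2 ^ Nat.log 2 (g n) ^ k ≤ 2 ^ P.eval n.size ^ k :=
    Nat.pow_le_pow_right two_pos (Nat.pow_le_pow_left (hP n) k)
  have h2 : a + 2 ≤ 2 ^ (a + 2) := (Nat.lt_two_pow_self).le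
  have h3 : a ≤ 2 ^ (a + 2) / 4 := by
    rw [pow_add]; norm_num
    have := Nat.lt_two_pow_self (n := a); omega
  rw [eval_add, eval_pow, eval_C, pow_add]
  set Y := 2 ^ P.eval n.size ^ k with hY
  have hY1 : 1 ≤ Y := Nat.one_le_two_pow
  calc a * 2 ^ Nat.log 2 (g n) ^ k + a + 2 ≤ a * Y + (a + 2) := by
        have := Nat.mul_le_mul_left a h1; omega
    _ ≤ a * Y + (a + 2) * Y := Nat.add_le_add_left (Nat.le_mul_of_pos_right _ hY1) _
    _ = (2 * a + 2) * Y := by ring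
    _ ≤ 2 ^ (a + 2) * Y := by
        refine Nat.mul_le_mul_right _ ?_
        rw [pow_add]; norm_num
        have := Nat.lt_two_pow_self (n := a); omega
    _ = Y * 2 ^ (a + 2) := Nat.mul_comm _ _

end QPBdd

end MachineAQ

/-! ### Tableau circuits under QUASI-POLYNOMIAL `ACC` circuits for `P` -/

namespace Tableau

attribute [local instance] Turing.FinTM2.kFin Turing.FinTM2.ΛFin Turing.FinTM2.σFin
  Turing.FinTM2.Γk₀Fin

/-- **Snapshot circuits for a prescribed modulus and depth, quasi-polynomial size**: as
`exists_snapshotCircuits_acc`, with the class of `P` being depth-`d` `accBasis m`-circuits of size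
`a · 2^{(log₂ n)^k} + a` (assumption (A) of Murray–Williams 2018, proof of Thm. 1.2, for the
languages of `P`): for every bundled machine `M` ONE constant `a` and one offset `V₀` bound, for
every word `x'`, certificate length `P`, bounds `T`, `S` and `t ≤ T`, `J ≤ S`, value `v`, an
`accBasis m`-circuit of depth `≤ d + 1` and size `≤ a · 2^{(log₂ N)^k} + a + 2`,
`N = 4 (|x'| + P + T + S) + V₀`, on the certificate bits deciding whether block `J` of configuration
`t` of `M` on `⟨x', u⟩` is `v`. [cite: Williams2014, Lemma 3.1 (proof); MurrayWilliams2018, Thm. 1.2 (proof, §5)] -/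
theorem exists_snapshotCircuits_accQ {m d k : ℕ}
    (hP : Classes.P ⊆ ⋃ a : ℕ,
      DepthSizeClass (accBasis m) (fun _ => d) (fun n => a * 2 ^ Nat.log 2 n ^ k + a))
    (M : TM2ComputableAux Bool Bool) :
    ∃ a V₀ : ℕ, ∀ (x' : List Bool) (P T S t J : ℕ) (v : Val M.tm),
      t ≤ T → J ≤ S → ∃ E : Circuit (Fin P), E.IsOver (accBasis m) ∧ E.acDepth ≤ d + 1 ∧
        E.size ≤ a * 2 ^ Nat.log 2 (4 * (x'.length + P + T + S) + V₀) ^ k + a + 2 ∧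
        ∀ u : Fin P → Bool,
          (E.eval u = true ↔ absVal (cfgOf M (boolPair x' (List.ofFn u)) t) J = v) := by
  classical
  have hL := hP (snapshot_mem_P_holds M)
  simp only [Set.mem_iUnion] at hL
  obtain ⟨a, C, hC, hdec⟩ := hL
  set V : ℕ := Nat.card (Val M.tm) with hV
  refine ⟨a, V + 10, fun x' P T S t J v ht hJ => ?_⟩
  set vn : ℕ := ((valEquiv M) v : ℕ) with hvn
  have hvV : vn < V := ((valEquiv M) v).isLt
  let τ : Template P := snapTemplate x' P t T J S vn V
  have hτlen : τ.length = 4 * x'.length + 2 * P + 2 * T + 2 * S + V + 10 :=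
    length_snapTemplate x' ht hJ hvV.le
  obtain ⟨E, hEB, hEs, hEd, hEe⟩ := hdec.exists_circuit_fill (B := accBasis m)
    (acBasis_subset_accBasis m (or_mem_acBasis 0)) (acBasis_subset_accBasis m (and_mem_acBasis 0))
    τ (hC τ.length).1
  refine ⟨E, hEB, hEd.trans (Nat.add_le_add_right (hC τ.length).2.1 1), hEs.trans ?_, fun u => ?_⟩
  · have h1 : (C τ.length).size ≤ a * 2 ^ Nat.log 2 τ.length ^ k + a := (hC τ.length).2.2
    have h2 : τ.length ≤ 4 * (x'.length + P + T + S) + (V + 10) := by rw [hτlen]; omega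
    have h3 : a * 2 ^ Nat.log 2 τ.length ^ k + a ≤
        a * 2 ^ Nat.log 2 (4 * (x'.length + P + T + S) + (V + 10)) ^ k + a := by
      have := Nat.log_mono_right (b := 2) h2
      gcongr
      exact one_le_two
    omega
  · rw [hEe u]
    have hfill : τ.fill u = snapQuery (boolPair x' (List.ofFn u)) t T J S vn V :=
      fill_snapTemplate x' P t T J S vn V u
    rw [hfill]
    have key : snapQuery (boolPair x' (List.ofFn u)) t T J S vn V ∈ snapshotLang M ↔
        absVal (cfgOf M (boolPair x' (List.ofFn u)) t) J = v := by
      rw [snapQuery_mem_iff _ hvV]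
      have : (valEquiv M).symm ⟨vn, hvV⟩ = v := by
        rw [Equiv.symm_apply_eq]
      rw [this]
    rw [← key]
    exact (Set.mem_iff_boolIndicator _ _).symm

/-- **Tableau-variable circuits for a prescribed modulus and depth, quasi-polynomial size**: as
`exists_tableauCircuits_acc` under the quasi-polynomial hypothesis: ONE constant `a` and ONE `D`
such that for every instance `x'`, certificate length `P`, time bound `T`, row `t ≤ T`, block
`J ≤ S₁` and value `v`, an `accBasis m`-circuit of depth `≤ d + 1` and size
`≤ a · 2^{(log₂ (D (|x'| + P + T) + D))^k} + a + 2` on the certificate bits computes the intended truth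
value of the tableau variable `(blk t J, v)` of the run of `M` on `⟨x', u⟩`.
[cite: Williams2014, Lemma 3.1 (proof); MurrayWilliams2018, Thm. 1.2 (proof, §5)] -/
theorem exists_tableauCircuits_accQ {m d k : ℕ}
    (hP : Classes.P ⊆ ⋃ a : ℕ,
      DepthSizeClass (accBasis m) (fun _ => d) (fun n => a * 2 ^ Nat.log 2 n ^ k + a))
    (M : TM2ComputableAux Bool Bool) :
    ∃ a D : ℕ, ∀ (x' : List Bool) (P T t J : ℕ) (v : Val M.tm),
      t ≤ T → J ≤ S1 M x'.length P T → ∃ E : Circuit (Fin P), E.IsOver (accBasis m) ∧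
        E.acDepth ≤ d + 1 ∧ E.size ≤ a * 2 ^ Nat.log 2 (D * (x'.length + P + T) + D) ^ k + a + 2 ∧
        ∀ u : Fin P → Bool,
          E.eval u = intended (M := M) x' P T (List.ofFn u) (blk M x'.length P T t J, v) := by
  obtain ⟨a, V₀, h⟩ := exists_snapshotCircuits_accQ hP M
  set dd : ℕ := dM M with hdd
  refine ⟨a, 4 * (dd + 3) + (4 * (3 * dd + 2) + V₀), fun x' P T t J v ht hJ => ?_⟩
  obtain ⟨E, hEB, hEd, hEs, hEe⟩ := h x' P T (S1 M x'.length P T) t J v ht hJ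
  refine ⟨E, hEB, hEd, hEs.trans ?_, fun u => ?_⟩
  · have hS : S1 M x'.length P T = 2 * x'.length + 2 + P + dd * T + 3 * dd := rfl
    have h2 : 4 * (x'.length + P + T + S1 M x'.length P T) + V₀ ≤
        (4 * (dd + 3) + (4 * (3 * dd + 2) + V₀)) * (x'.length + P + T) +
          (4 * (dd + 3) + (4 * (3 * dd + 2) + V₀)) := by rw [hS]; nlinarith
    have h3 := Nat.log_mono_right (b := 2) h2
    gcongr
    exact one_le_two
  · rw [Bool.eq_iff_iff, hEe u, intended_blk (List.ofFn u) hJ v, cfgAt_eq_cfgOf]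
    exact eq_comm

end Tableau

/-! ### Completeness of the check: good families of quasi-polynomial size -/

namespace MachineAQ

open MachineA Tableau

attribute [local instance] Turing.FinTM2.kFin Turing.FinTM2.ΛFin Turing.FinTM2.σFin
  Turing.FinTM2.Γk₀Fin

variable {M : TM2ComputableAux Bool Bool} {cl : List Bool → ℕ → Clause ℕ}

/-- **Completeness of the check from tableau circuits of any monotone size** (the proof of
`MachineA.exists_goodFamilies`, Williams 2014, proof of Lemma 3.1: "there is always at least one
computation path of `A(x)` that prints the circuit", with the polynomial `q₀` of the tableau circuits
replaced by an arbitrary monotone bound `B`): for every input `x` there are families of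
`accBasis m`-circuits of depth `≤ dd` and size `≤ B (bigPoly n)` — the intended tableau circuits of
the runs of the clause-bit machine — on which VALUE is identically `0`.
[cite: Williams2014, Lemma 3.1 (proof)] -/
theorem exists_goodFamilies_of_tableau {m dd : ℕ} (hm : 0 < m) {B : ℕ → ℕ} (hB : Monotone B)
    (hT : ∀ (x' : List Bool) (P T t J : ℕ) (v : Val M.tm),
      t ≤ T → J ≤ S1 M x'.length P T → ∃ E : Circuit (Fin P), E.IsOver (accBasis m) ∧
        E.acDepth ≤ dd ∧ E.size ≤ B (x'.length + P + T) ∧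
        ∀ u : Fin P → Bool,
          E.eval u = intended (M := M) x' P T (List.ofFn u) (blk M x'.length P T t J, v))
    {pT : Polynomial ℕ}
    (hM : ∀ z, M.OutputsWithin z [bitFun cl z] (pT.eval z.length)) (c : ℕ) :
    ∀ x : List Bool, ∃ E : ℕ → ℕ → Circuit (Fin (succinctWidth c x.length)),
      (∀ φ r, (E φ r).IsOver (accBasis m) ∧ (E φ r).acDepth ≤ dd ∧
        (E φ r).size ≤ B ((bigPoly c pT).eval x.length) ∧
        (E φ r).maxFanIn ≤ m * (succinctWidth c x.length + B ((bigPoly c pT).eval x.length))) ∧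
      ∀ u, dnfVal ((List.range (nFam c x.length)).flatMap fun φ => (List.range (NVn c M pT x.length)).map (E φ))
        (allTerms M c pT x) u = false := by
  classical
  intro x
  have hNV := NVn_pos c M pT x.length
  have hV : 0 < Vc M := by unfold Vc; exact Nat.card_pos
  have hK : 0 < 3 * (succinctWidth c x.length + 2) := by omega
  have hRBeq : RBn c M pT x.length =
      S1 M (nX c x.length) (succinctWidth c x.length) (TT c pT x.length) + 1 := rfl
  have hS1 := Tableau.S1_unfold M (nX c x.length) (succinctWidth c x.length) (TT c pT x.length)
  have hd1 := Tableau.one_le_dM M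
  -- the circuit of variable number `r` of family `φ` (indices clamped into range)
  have key : ∀ φ r : ℕ, ∃ E : Circuit (Fin (succinctWidth c x.length)),
      E.IsOver (accBasis m) ∧ E.acDepth ≤ dd ∧ E.size ≤ B ((bigPoly c pT).eval x.length) ∧
      E.maxFanIn ≤ m * (succinctWidth c x.length + B ((bigPoly c pT).eval x.length)) ∧
      (φ < nFam c x.length → r < NVn c M pT x.length → ∀ u,
        E.eval u = intended (M := M) (xq' c x (φ / 2) (decide (φ % 2 = 1))) (succinctWidth c x.length)
          (TT c pT x.length) (List.ofFn u) (r / Vc M, (valEquiv M).symm ⟨r % Vc M, Nat.mod_lt _ hV⟩)) := by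
    intro φ r
    set p' := φ / 2 % (3 * (succinctWidth c x.length + 2)) with hp'
    have hp'lt : p' < 3 * (succinctWidth c x.length + 2) := Nat.mod_lt _ hK
    set r' := r % NVn c M pT x.length with hr'
    have hr'lt : r' < NVn c M pT x.length := Nat.mod_lt _ hNV
    have hb : r' / Vc M < Rn c M pT x.length := by
      unfold NVn at hr'lt
      exact Nat.div_lt_of_lt_mul (by rwa [Nat.mul_comm] at hr'lt)
    have ht : r' / Vc M / RBn c M pT x.length ≤ TT c pT x.length := by
      unfold Rn at hb
      have := Nat.div_lt_of_lt_mul (by rwa [Nat.mul_comm] at hb)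
      omega
    have hJ : r' / Vc M % RBn c M pT x.length ≤
        S1 M (nX c x.length) (succinctWidth c x.length) (TT c pT x.length) := by
      have := Nat.mod_lt (r' / Vc M) (show 0 < RBn c M pT x.length by rw [hRBeq]; omega)
      omega
    have hlen := length_xq' c x hp'lt (decide (φ % 2 = 1))
    obtain ⟨E, hEO, hEd, hEs, hEe⟩ := hT (xq' c x p' (decide (φ % 2 = 1))) (succinctWidth c x.length)
      (TT c pT x.length) (r' / Vc M / RBn c M pT x.length) (r' / Vc M % RBn c M pT x.length)
      ((valEquiv M).symm ⟨r' % Vc M, Nat.mod_lt _ hV⟩) ht (by rw [hlen]; exact hJ)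
    have hsz : E.size ≤ B ((bigPoly c pT).eval x.length) := by
      refine hEs.trans ?_
      rw [hlen]
      exact hB (nX_add_le_bigPoly c pT x.length)
    refine ⟨E.normFanIn m, Circuit.isOver_normFanIn hEO, (Circuit.acDepth_normFanIn_le m E).trans hEd,
      by rwa [Circuit.size_normFanIn], (Circuit.maxFanIn_normFanIn_le hm hEO).trans
        (Nat.mul_le_mul_left m (Nat.add_le_add_left hsz _)), fun hφ hr u => ?_⟩
    · have hpp : p' = φ / 2 := Nat.mod_eq_of_lt (by unfold nFam at hφ; omega)
      have hrr : r' = r := Nat.mod_eq_of_lt hr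
      rw [Circuit.eval_normFanIn, hEe u]
      have hblk : blk M (xq' c x p' (decide (φ % 2 = 1))).length (succinctWidth c x.length)
          (TT c pT x.length) (r' / Vc M / RBn c M pT x.length) (r' / Vc M % RBn c M pT x.length) = r' / Vc M := by
        rw [hlen]
        exact Nat.div_add_mod' _ _
      rw [hblk]
      simp only [hpp, hrr]
  choose E hE using key
  refine ⟨E, fun φ r => ⟨(hE φ r).1, (hE φ r).2.1, (hE φ r).2.2.1, (hE φ r).2.2.2.1⟩, fun u => ?_⟩
  rw [dnfVal_allTerms_eq_false_iff]
  intro φ hφ hsel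
  have hp : φ / 2 < 3 * (succinctWidth c x.length + 2) := by unfold nFam at hφ; omega
  have hlen := length_xq' c x hp (decide (φ % 2 = 1))
  -- the guessed assignment of family `φ` IS the intended one on all blocks below `R`
  have agree : ∀ {φ' : ℕ} (hφ' : φ' < nFam c x.length) (bv : TVar M), bv.1 < Rn c M pT x.length →
      τ M (NVn c M pT x.length) ((List.range (nFam c x.length)).flatMap fun φ =>
        (List.range (NVn c M pT x.length)).map (E φ)) φ' u bv =
      intended (M := M) (xq' c x (φ' / 2) (decide (φ' % 2 = 1))) (succinctWidth c x.length)
        (TT c pT x.length) (List.ofFn u) bv := by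
    intro φ' hφ' bv hb
    show blockVal _ u (φ' * NVn c M pT x.length + rIdx M bv) = _
    rw [blockVal_flatMap E u hφ' (rIdx_lt c pT hb), (hE φ' (rIdx M bv)).2.2.2.2 hφ' (rIdx_lt c pT hb) u]
    have h2 : (⟨rIdx M bv % Vc M, Nat.mod_lt _ hV⟩ : Fin (Nat.card (Val M.tm))) = (valEquiv M) bv.2 :=
      Fin.ext (rIdx_mod bv)
    rw [rIdx_div, h2, Equiv.symm_apply_apply]
  -- the coordinate at position `φ / 2`, the run of the clause-bit machine and its bit
  set κ : ClauseCoord (succinctWidth c x.length) := WitnessCheck.coordOf ⟨φ / 2, hp⟩ with hκdef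
  have hκ : WitnessCheck.coordPos κ = φ / 2 := WitnessCheck.coordPos_coordOf _
  have hxq : ∀ pol', xq c x κ pol' = xq' c x (φ / 2) pol' := fun pol' => by rw [xq_eq_xq', hκ]
  have hrun : ∀ pol', M.OutputsWithin (boolPair (xq' c x (φ / 2) pol') (List.ofFn u))
      [bitFun cl (boolPair (xq' c x (φ / 2) pol') (List.ofFn u))] (TT c pT x.length) := fun pol' => by
    rw [← hxq]; exact outputsWithin_xq hM c x κ pol' u
  have hbit : ∀ pol', bitFun cl (boolPair (xq' c x (φ / 2) pol') (List.ofFn u)) =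
      xor (clauseMap _ (cl x) u κ) pol' := fun pol' => by rw [← hxq]; exact bitFun_xq cl c x κ pol' u
  -- the guard reads the clause bit
  have h0 : φ / 2 * 2 < nFam c x.length := by unfold nFam at hφ ⊢; omega
  have hoR : (outVar c M pT x.length).1 < Rn c M pT x.length :=
    Tableau.blk_lt M _ _ _ le_rfl (by omega)
  have hout : blockVal ((List.range (nFam c x.length)).flatMap fun φ =>
      (List.range (NVn c M pT x.length)).map (E φ)) u (φ / 2 * 2 * NVn c M pT x.length + rOut c M pT x.length) =
      clauseMap _ (cl x) u κ := by
    have h1 : φ / 2 * 2 * NVn c M pT x.length + rOut c M pT x.length =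
        φ / 2 * 2 * NVn c M pT x.length + rIdx M (outVar c M pT x.length) := rfl
    have h2 := agree h0 (outVar c M pT x.length) hoR
    unfold τ at h2
    rw [h1, h2, show φ / 2 * 2 / 2 = φ / 2 by omega, show decide (φ / 2 * 2 % 2 = 1) = false by simp]
    unfold outVar
    rw [← length_xq' c x hp false, Tableau.intended_outVar (hrun false), hbit false, Bool.xor_false]
  -- hence the clause-bit machine accepts `⟨x'_{p,pol}, u⟩`
  have hf : bitFun cl (boolPair (xq' c x (φ / 2) (decide (φ % 2 = 1))) (List.ofFn u)) = true := by
    rw [hbit]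
    rw [litVal_selLit, hout] at hsel
    exact hsel
  have hcl := Tableau.complete (M := M) (x := xq' c x (φ / 2) (decide (φ % 2 = 1)))
    (P := succinctWidth c x.length) (T := TT c pT x.length) (u := List.ofFn u) (by simp) (hrun _) hf
  refine ⟨fun C hC => ?_, fun j hj => ?_⟩
  · rw [Tableau.HClause.holds_congr fun bv hbv => agree hφ bv ?_]
    · exact hcl C hC
    · have := Tableau.fst_lt_of_mem_clauses M hC hbv
      rwa [hlen] at this
  · have hpin := Tableau.pinned_intended (M := M) (x := xq' c x (φ / 2) (decide (φ % 2 = 1)))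
      (P := succinctWidth c x.length) (T := TT c pT x.length) (u := List.ofFn u) (by simp) j hj
    rw [agree hφ]
    · exact hpin
    · simp only [List.length_ofFn] at hj
      rw [hlen]
      exact Tableau.blk_lt M _ _ _ (Nat.zero_le _) (by omega)

/-- **Completeness of the check under quasi-polynomial `ACC` circuits for `P`** (Williams 2014,
proof of Lemma 3.1, run under assumption (A) of Murray–Williams 2018, proof of Thm. 1.2): for every
input `x` there are families of `accBasis m`-circuits of depth `≤ d + 1` and size `≤ 2^{P₀(size n)}`
for ONE polynomial `P₀` — the intended tableau circuits of the runs of the clause-bit machine — on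
which VALUE is identically `0`.
[cite: Williams2014, Lemma 3.1 (proof); MurrayWilliams2018, Thm. 1.2 (proof, §5)] -/
theorem exists_goodFamiliesQ {m d k : ℕ} (hm : 0 < m)
    (hP : Classes.P ⊆ ⋃ a : ℕ,
      DepthSizeClass (accBasis m) (fun _ => d) (fun n => a * 2 ^ Nat.log 2 n ^ k + a))
    {pT : Polynomial ℕ}
    (hM : ∀ z, M.OutputsWithin z [bitFun cl z] (pT.eval z.length)) (c : ℕ) :
    ∃ P₀ : Polynomial ℕ, ∀ x : List Bool, ∃ E : ℕ → ℕ → Circuit (Fin (succinctWidth c x.length)),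
      (∀ φ r, (E φ r).IsOver (accBasis m) ∧ (E φ r).acDepth ≤ d + 1 ∧
        (E φ r).size ≤ 2 ^ P₀.eval (Nat.size x.length) ∧
        (E φ r).maxFanIn ≤ m * (succinctWidth c x.length + 2 ^ P₀.eval (Nat.size x.length))) ∧
      ∀ u, dnfVal ((List.range (nFam c x.length)).flatMap fun φ => (List.range (NVn c M pT x.length)).map (E φ))
        (allTerms M c pT x) u = false := by
  obtain ⟨a, D, hT⟩ := Tableau.exists_tableauCircuits_accQ hP M
  -- the monotone size bound of the tableau circuits and its quasi-polynomial majorant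
  set B : ℕ → ℕ := fun N => a * 2 ^ Nat.log 2 (D * N + D) ^ k + a + 2 with hBdef
  have hBm : Monotone B := fun N N' h => by
    simp only [hBdef]
    have := Nat.log_mono_right (b := 2) (show D * N + D ≤ D * N' + D by nlinarith)
    gcongr
    exact one_le_two
  have hg : QPBdd fun n => D * (bigPoly c pT).eval n + D :=
    (((QPBdd.const D).mul (QPBdd.poly _)).add (QPBdd.const D))
  obtain ⟨P₀, hP₀⟩ := QPBdd.exists_accSize_le a k hg
  refine ⟨P₀, fun x => ?_⟩
  obtain ⟨E, hE, hval⟩ := exists_goodFamilies_of_tableau (M := M) (cl := cl) hm hBm hT hM c x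
  have hle : B ((bigPoly c pT).eval x.length) ≤ 2 ^ P₀.eval (Nat.size x.length) := hP₀ x.length
  refine ⟨E, fun φ r => ⟨(hE φ r).1, (hE φ r).2.1, (hE φ r).2.2.1.trans hle,
    (hE φ r).2.2.2.trans (Nat.mul_le_mul_left m (Nat.add_le_add_left hle _))⟩, hval⟩

end MachineAQ

/-! ### Good printouts with an explicit bound -/

/-- **Good printouts of the generator with an explicit numeric bound `b`** (cf.
`GoodClauseCircuits`, whose bound is `|x| ^ e_G + e_G`): `z` prints, along `clauseCoordList`,
circuits `G κ` over `accBasis m` on `w = succinctWidth c |x|` inputs with `acDepth ≤ dG`, at most `b`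
gates and fan-in at most `b`, the circuit `G κ` computing coordinate `κ` of the clause map of `cl x`
(Williams 2014, Lemma 3.1: "prints an `ACC` circuit `C'ₓ` … and `S(n + d log n)` size", `S` now
quasi-polynomial). [cite: Williams2014, Lemma 3.1] -/
def GoodClauseCircuitsB (c : ℕ) (cl : List Bool → ℕ → Clause ℕ) (m dG b : ℕ) (x z : List Bool) :
    Prop :=
  ∃ G : ClauseCoord (succinctWidth c x.length) → Circuit (Fin (succinctWidth c x.length)),
    (∀ κ, (G κ).IsOver (accBasis m) ∧ (G κ).acDepth ≤ dG ∧ (G κ).size ≤ b ∧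
      (G κ).maxFanIn ≤ b ∧
        ∀ i, (G κ).eval i = clauseMap (succinctWidth c x.length) (cl x) i κ) ∧
    z = encodeAccCircuitList m ((clauseCoordList (succinctWidth c x.length)).map G)

/-- Monotonicity of `GoodClauseCircuitsB` in the bound. [folklore] -/
theorem GoodClauseCircuitsB.mono {c : ℕ} {cl : List Bool → ℕ → Clause ℕ} {m dG b b' : ℕ}
    {x z : List Bool} (h : GoodClauseCircuitsB c cl m dG b x z) (hb : b ≤ b') :
    GoodClauseCircuitsB c cl m dG b' x z := by
  obtain ⟨G, hG, hz⟩ := h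
  exact ⟨G, fun κ => ⟨(hG κ).1, (hG κ).2.1, (hG κ).2.2.1.trans hb, (hG κ).2.2.2.1.trans hb,
    (hG κ).2.2.2.2⟩, hz⟩

/-- The polynomial `GoodClauseCircuits` is `GoodClauseCircuitsB` at `b = |x| ^ e_G + e_G`.
[folklore] -/
theorem goodClauseCircuits_iff_B (c : ℕ) (cl : List Bool → ℕ → Clause ℕ) (m dG eG : ℕ)
    (x z : List Bool) :
    GoodClauseCircuits c cl m dG eG x z ↔ GoodClauseCircuitsB c cl m dG (x.length ^ eG + eG) x z :=
  Iff.rfl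

/-! ### The stage function of `A` at quasi-polynomial size is polynomial time -/

namespace MachineAQ

open MachineA SatCode Tableau GateList WitnessCheck MachineB CodeFP Brick TM2Comp

attribute [local instance] Turing.FinTM2.kFin Turing.FinTM2.ΛFin Turing.FinTM2.σFin
  Turing.FinTM2.Γk₀Fin

/-- `size n ≤ n`. [folklore] -/
private theorem size_le_self (n : ℕ) : Nat.size n ≤ n := Nat.size_le.2 Nat.lt_two_pow_self

/-- **The numeral `2^{P(size n)}` from `1ⁿ`** (the quasi-polynomial size bound of the guessed
circuits, on binary numerals): `size n` is the length of the numeral of `n`, turned unary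
(`unOfNatMin`, it is `≤ n`), the polynomial is evaluated in unary (`unPoly_code`), and the power of
two with a unary exponent is `natPow`. [cite: AroraBarakCC2009, §1.3] -/
theorem twoPowPolySize_code (P : Polynomial ℕ) :
    CodeFP unE natE (fun n => 2 ^ P.eval (Nat.size n)) := by
  have hn : CodeFP unE unE (fun n => n) := CodeFP.id unE
  have hsN := natSize_code.comp (natOfUn.comp hn)
  have hsU := unOfNatMin.comp (hn.pair hsN)
  have hP := (unPoly_code P).comp hsU
  have h := natPow.comp ((cst unE natE 2).pair hP)
  exact h.congr fun n => by simp [Nat.min_eq_left (size_le_self n)]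

/-- **The flagged instance word** handed to the SAT stage of the quasi-polynomial `A` at threshold
`N₀`: the code of VALUE behind the flag `1` when the input is long (`N₀ ≤ n`) AND the guess is
admissible, and the word `0 1` ("answer: satisfiable", i.e. reject) otherwise — short inputs are
rejected outright, without the SAT call, whose algorithm is not specified on their instances.
[folklore] -/
def instQ (N₀ n : ℕ) (ok : Bool) (code : List ℕ) : List Bool :=
  if decide (N₀ ≤ n) && ok then true :: listE natE code else [false, true]

/-- `instQ` on a long input with an admissible guess. [folklore] -/
theorem instQ_of_le {N₀ n : ℕ} (h : N₀ ≤ n) (code : List ℕ) :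
    instQ N₀ n true code = true :: listE natE code := by
  simp [instQ, h]

/-- `instQ` on a short input. [folklore] -/
theorem instQ_of_lt {N₀ n : ℕ} (h : n < N₀) (ok : Bool) (code : List ℕ) :
    instQ N₀ n ok code = [false, true] := by
  simp [instQ, Nat.not_le.2 h]

/-- `instQ` on an inadmissible guess. [folklore] -/
theorem instQ_false (N₀ n : ℕ) (code : List ℕ) : instQ N₀ n false code = [false, true] := by
  simp [instQ]

/-- **The packed output of the quasi-polynomial stage**: `⟨instQ, ⟨[ok], listE (listE natE) print⟩⟩`.
[folklore] -/
def packAQ (N₀ n : ℕ) (r : List ℕ × Bool × List (List ℕ)) : List Bool :=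
  boolPair (instQ N₀ n r.2.1 r.1) (boolPair [r.2.1] (listE (listE natE) r.2.2))

section Stage

variable (c m : ℕ) (M : TM2ComputableAux Bool Bool) (pT : Polynomial ℕ) (dE : ℕ) (P₀ : Polynomial ℕ)
  (N₀ : ℕ)

/-- **The packed stage function of the quasi-polynomial `A` is computed by an `FP` function on
pairs**: Williams' stage function `stageA` (parse, validate, print VALUE and `C'ₓ`) with the size
bound of the validation instantiated, at input length `n`, to the constant polynomial
`C (2^{P₀(size n)})`, followed by the threshold dispatch of `packAQ`. The proof is that of
`MachineA.exists_stageAFn` with the numeral `q_E(n)` replaced by the numeral `2^{P₀(size n)}`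
(`twoPowPolySize_code`). [cite: Williams2014, Lemma 3.1 (proof); MurrayWilliams2018, Thm. 1.2 (proof, §5)] -/
theorem exists_stageAQFn : ∃ F : List Bool → List Bool, F ∈ FP ∧
    ∀ x z, F (boolPair x z) =
      packAQ N₀ x.length (stageA c m M pT dE (Polynomial.C (2 ^ P₀.eval (Nat.size x.length))) x z) := by
  -- input `(x, z)`
  have hx : CodeFP (pairE strE strE) strE (fun p => p.1) := fst _ _
  have hz : CodeFP (pairE strE strE) strE (fun p => p.2) := snd _ _
  have hctx := (ctxOf_code c M pT).comp hx
  have hwU := hctx.snd'.fst'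
  have hw := natOfUn.comp hwU
  have hNV := hctx.snd'.snd'.snd'.snd'.snd'.fst'
  have hrO := hctx.snd'.snd'.snd'.snd'.snd'.snd'
  have hsz : CodeFP (pairE strE strE) natE
      (fun p => (Polynomial.C (2 ^ P₀.eval (Nat.size p.1.length))).eval p.1.length) :=
    ((twoPowPolySize_code P₀).comp (strLength.comp hx)).congr fun p => by simp
  have hnFU := unMul.comp ((cst _ unE 2).pair (unMul.comp ((cst _ unE 3).pair (unAdd.comp (hwU.pair (cst _ unE 2))))))
  have hnF := natOfUn.comp hnFU
  have hfams := parseGuess_code.comp hz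
  -- the flag, the block codes, the terms
  have hok := (famsOK_code dE).comp ((hw.pair (hsz.pair (hNV.pair hnF))).pair hfams)
  have hbcs := hok.ite ((map₀ (codeBlock_code m)).comp ((flatten (rawE natE)).comp hfams))
    (nil' (pairE strE strE) blockE)
  have hterms := hok.ite ((allTermsG_code M).comp hctx) (nil' (pairE strE strE) (rawE litE))
  -- VALUE and the printout
  have hdnf := dnfCodeList_code.comp (hwU.pair (hbcs.pair hterms))
  have pq : CodeFP (pairE (pairE strE strE) natE) (pairE strE strE) (fun t => t.1) := fst _ _
  have pp : CodeFP (pairE (pairE strE strE) natE) natE (fun t => t.2) := snd _ _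
  have hidx := natAdd.comp ((natMul.comp ((natMul.comp ((cst _ natE 2).pair pp)).pair (hNV.comp pq))).pair (hrO.comp pq))
  have hblk := (rawGetOr blockE).comp ((hbcs.comp pq).pair (hidx.pair (cst _ blockE (((0 : ℕ), (0 : ℕ)), ([] : List GateC)))))
  have hser := serialize_code.comp ((hw.comp pq).pair (hblk.fst'.pair hblk.snd'))
  have hprint := map' hser (urange' (unMul.comp ((cst _ unE 3).pair (unAdd.comp (hwU.pair (cst _ unE 2))))))
  -- the threshold dispatch
  have hn := strNatLength.comp hx
  have hlong := natLe.comp ((cst _ natE N₀).pair hn)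
  have hconsT : CodeFP strE strE (List.cons true) := of_fn (List.cons true) (cons_mem_FP true) fun _ => rfl
  have hinst := (hlong.and hok).ite (hconsT.comp (listStr_code.comp hdnf)) (cst _ strE [false, true])
  -- packing
  have hpack : CodeFP (pairE strE strE) strE (fun p => packAQ N₀ p.1.length (dnfCodeList (succinctWidth c p.1.length)
      (if famsOK (succinctWidth c p.1.length) dE ((Polynomial.C (2 ^ P₀.eval (Nat.size p.1.length))).eval p.1.length)
          (NVn c M pT p.1.length) (nFam c p.1.length) (parseGuess p.2)
        then (parseGuess p.2).flatten.map (codeBlock m) else [])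
      (if famsOK (succinctWidth c p.1.length) dE ((Polynomial.C (2 ^ P₀.eval (Nat.size p.1.length))).eval p.1.length)
          (NVn c M pT p.1.length) (nFam c p.1.length) (parseGuess p.2)
        then allTermsG M (ctxOf c M pT p.1) else []),
      famsOK (succinctWidth c p.1.length) dE ((Polynomial.C (2 ^ P₀.eval (Nat.size p.1.length))).eval p.1.length)
        (NVn c M pT p.1.length) (nFam c p.1.length) (parseGuess p.2),
      (List.range (3 * (succinctWidth c p.1.length + 2))).map fun pos => serialize (succinctWidth c p.1.length)
        ((if famsOK (succinctWidth c p.1.length) dE ((Polynomial.C (2 ^ P₀.eval (Nat.size p.1.length))).eval p.1.length)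
            (NVn c M pT p.1.length) (nFam c p.1.length) (parseGuess p.2)
          then (parseGuess p.2).flatten.map (codeBlock m) else []).getD (2 * pos * NVn c M pT p.1.length + rOut c M pT p.1.length)
          (((0 : ℕ), (0 : ℕ)), ([] : List GateC))).1
        ((if famsOK (succinctWidth c p.1.length) dE ((Polynomial.C (2 ^ P₀.eval (Nat.size p.1.length))).eval p.1.length)
            (NVn c M pT p.1.length) (nFam c p.1.length) (parseGuess p.2)
          then (parseGuess p.2).flatten.map (codeBlock m) else []).getD (2 * pos * NVn c M pT p.1.length + rOut c M pT p.1.length)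
          (((0 : ℕ), (0 : ℕ)), ([] : List GateC))).2)) :=
    (hinst.pair (hok.pair (listListStr_code.comp hprint))).recodeOut fun p => by
      simp only [pairE_apply, packAQ, instQ, id, bitE, nFam]
      rfl
  obtain ⟨F, hF, hFeq⟩ := hpack
  refine ⟨F, hF, fun x z => ?_⟩
  rw [show boolPair x z = pairE strE strE (x, z) from rfl, hFeq]
  simp only [stageA, okA, bcsA, termsA, printA, outIdx, allTermsG_ctxOf]
  rfl

end Stage

end MachineAQ

/-! ### Arithmetic of the running time -/

namespace MachineAQ

open MachineA MachineB Tableau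

/-- **A polynomial of `O(n) + rootClockLen r' c' n` is `O(n + 2ⁿ/n)`** for `r' ≥ 3`: every stage
cost of the machine at its subexponential yardstick. [folklore] -/
theorem exists_poly_rootClockLen_le_williamsBound (p : Polynomial ℕ) {r' : ℕ} (hr' : 3 ≤ r')
    (c' a b : ℕ) : ∃ K : ℕ, ∀ n : ℕ,
      p.eval (a * n + b + rootClockLen r' c' n) ≤ K * williamsBound n + K := by
  obtain ⟨Ac, e, hpF⟩ := exists_eval_le_mul_pow_add p
  obtain ⟨KQ, hKQ⟩ := exists_poly_mul_two_pow_nthRoot_le_williamsBound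
    (Polynomial.C Ac * (Polynomial.C a * X + Polynomial.C (b + 2 * c' + 1)) ^ e) hr' e
  refine ⟨KQ + Ac, fun n => ?_⟩
  have h1 := Nat.one_le_two_pow (n := Nat.nthRoot r' n)
  have hin : a * n + b + rootClockLen r' c' n ≤
      (a * n + (b + 2 * c' + 1)) * 2 ^ Nat.nthRoot r' n := by
    unfold rootClockLen
    nlinarith [Nat.mul_le_mul_left (a * n) h1, Nat.mul_le_mul_left b h1, Nat.mul_le_mul_left c' h1]
  have h2 : ((a * n + (b + 2 * c' + 1)) * 2 ^ Nat.nthRoot r' n) ^ e ≤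
      (a * n + (b + 2 * c' + 1)) ^ e * 2 ^ (e * Nat.nthRoot r' n + e) := by
    rw [mul_pow, ← pow_mul, mul_comm (Nat.nthRoot r' n) e]
    exact Nat.mul_le_mul_left _ (Nat.pow_le_pow_right two_pos (Nat.le_add_right _ _))
  have h3 := hKQ n
  simp only [eval_mul, eval_C, eval_pow, eval_add, eval_X] at h3
  calc p.eval (a * n + b + rootClockLen r' c' n)
      ≤ p.eval ((a * n + (b + 2 * c' + 1)) * 2 ^ Nat.nthRoot r' n) := natPoly_eval_mono p hin
    _ ≤ Ac * ((a * n + (b + 2 * c' + 1)) * 2 ^ Nat.nthRoot r' n) ^ e + Ac := hpF _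
    _ ≤ Ac * ((a * n + (b + 2 * c' + 1)) ^ e * 2 ^ (e * Nat.nthRoot r' n + e)) + Ac := by gcongr
    _ = Ac * (a * n + (b + 2 * c' + 1)) ^ e * 2 ^ (e * Nat.nthRoot r' n + e) + Ac := by ring
    _ ≤ KQ * williamsBound n + KQ + Ac := Nat.add_le_add_right h3 _
    _ ≤ (KQ + Ac) * williamsBound n + (KQ + Ac) := by nlinarith

/-- The yardstick at input length `n` with size bound `S`: `yard c m M pT (C S) n`, unfolded.
[folklore] -/
theorem yard_C (c m : ℕ) (M : TM2ComputableAux Bool Bool) (pT : Polynomial ℕ) (S n : ℕ) :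
    yard c m M pT (Polynomial.C S) n =
      guessLen (succinctWidth c n) (nFam c n) (NVn c M pT n) S (m * (succinctWidth c n + S)) := by
  simp [yard]

/-- The yardstick with the quasi-polynomial size bound is quasi-polynomial. [folklore] -/
theorem qpBdd_yard (c m : ℕ) (M : TM2ComputableAux Bool Bool) (pT : Polynomial ℕ) (P₀ : Polynomial ℕ) :
    QPBdd fun n => yard c m M pT (Polynomial.C (2 ^ P₀.eval (Nat.size n))) n := by
  have hS : QPBdd fun n => 2 ^ P₀.eval (Nat.size n) := QPBdd.twoPow P₀
  have hw : QPBdd (succinctWidth c) := QPBdd.of_polyBdd (polyBdd_width c)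
  have hNV : QPBdd (NVn c M pT) := QPBdd.of_polyBdd (polyBdd_NVn c M pT)
  have hnF : QPBdd (nFam c) := QPBdd.of_polyBdd (polyBdd_nFam c)
  have hφ : QPBdd fun n => m * (succinctWidth c n + 2 ^ P₀.eval (Nat.size n)) := (QPBdd.const m).mul (hw.add hS)
  have hcl : QPBdd fun n => codeLen (succinctWidth c n) (2 ^ P₀.eval (Nat.size n))
      (m * (succinctWidth c n + 2 ^ P₀.eval (Nat.size n))) := by
    unfold codeLen
    exact (QPBdd.const 2).add (((QPBdd.const 4).add (hS.mul (((QPBdd.const 2).mul hφ).add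
      (QPBdd.const 2)))).mul (((QPBdd.const 2).mul ((hw.add hS).add hφ)).add (QPBdd.const 14)))
  refine QPBdd.of_le (g := fun n => guessLen (succinctWidth c n) (nFam c n) (NVn c M pT n)
    (2 ^ P₀.eval (Nat.size n)) (m * (succinctWidth c n + 2 ^ P₀.eval (Nat.size n)))) ?_
    (fun n => (yard_C c m M pT _ n).le)
  unfold guessLen
  exact (((QPBdd.const 2).mul hnF).add (QPBdd.const 2)).add (hnF.mul (((QPBdd.const 2).mul
    ((((QPBdd.const 2).mul hNV).add (QPBdd.const 2)).add (hNV.mul (((QPBdd.const 2).mul hcl).add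
      (QPBdd.const 2))))).add (QPBdd.const 2)))

/-- The size bound of VALUE with the quasi-polynomial size bound is quasi-polynomial. [folklore] -/
theorem qpBdd_sizeBd (c : ℕ) (M : TM2ComputableAux Bool Bool) (pT : Polynomial ℕ) (P₀ : Polynomial ℕ) :
    QPBdd fun n => sizeBd c M pT (Polynomial.C (2 ^ P₀.eval (Nat.size n))) n := by
  have hS : QPBdd fun n => 2 ^ P₀.eval (Nat.size n) := QPBdd.twoPow P₀
  have h : QPBdd fun n => nFam c n * NVn c M pT n * 2 ^ P₀.eval (Nat.size n) + 2 +
      nFam c n * NVn c M pT n + succinctWidth c n + termsLen c M pT n + 1 :=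
    ((((((QPBdd.of_polyBdd (polyBdd_nFam c)).mul (QPBdd.of_polyBdd (polyBdd_NVn c M pT))).mul hS).add
      (QPBdd.const 2)).add ((QPBdd.of_polyBdd (polyBdd_nFam c)).mul (QPBdd.of_polyBdd (polyBdd_NVn c M pT)))).add
      (QPBdd.of_polyBdd (polyBdd_width c))).add (QPBdd.of_polyBdd (polyBdd_termsLen c M pT)) |>.add (QPBdd.const 1)
  refine h.of_le fun n => ?_
  simp [sizeBd]

/-- The quasi-polynomial part of the fan-in bound of VALUE. [folklore] -/
theorem qpBdd_fanRest (c m : ℕ) (M : TM2ComputableAux Bool Bool) (pT : Polynomial ℕ) (P₀ : Polynomial ℕ) :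
    QPBdd fun n => m * (succinctWidth c n + 2 ^ P₀.eval (Nat.size n)) + (cw M + 1) + termsLen c M pT n + 1 :=
  ((((QPBdd.const m).mul ((QPBdd.of_polyBdd (polyBdd_width c)).add (QPBdd.twoPow P₀))).add
    (QPBdd.const _)).add (QPBdd.of_polyBdd (polyBdd_termsLen c M pT))).add (QPBdd.const 1)

end MachineAQ

/-! ### Nondeterministic generation on long inputs -/

/-- **Nondeterministic generation from input length `N₀` on** (cf. `NGenerates`, Williams 2014,
Lemma 3.1: "there is always at least one computation path of `A(x)` that prints"): as
`NGenerates t P` — a constant `c`, an acceptance relation, an output function and a machine printing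
`ok x y :: out x y` on `⟨x, y⟩` within `c · (t |x| + |y|) + c` steps, accepted outputs being good on
EVERY input — except that an accepted guess of admissible length is only required for the inputs of
length `≥ N₀` (the machine `B` of Williams' Thm. 3.2 patches finitely many input lengths anyway,
`mem_NTIME_of_eqOn`). [cite: Williams2014, Lemma 3.1] -/
def NGeneratesFrom (N₀ : ℕ) (t : ℕ → ℕ) (P : List Bool → List Bool → Prop) : Prop :=
  ∃ (c : ℕ) (ok : List Bool → List Bool → Bool) (out : List Bool → List Bool → List Bool)
    (M : TM2ComputableAux Bool Bool),
    (∀ x y : List Bool,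
      M.OutputsWithin (boolPair x y) (ok x y :: out x y) (c * (t x.length + y.length) + c)) ∧
    (∀ x y : List Bool, ok x y = true → P x (out x y)) ∧
    (∀ x : List Bool, N₀ ≤ x.length → ∃ y : List Bool, y.length ≤ c * t x.length + c ∧ ok x y = true)

/-- Generation on all inputs is generation from every length on. [folklore] -/
theorem NGenerates.from {t : ℕ → ℕ} {P : List Bool → List Bool → Prop} (h : NGenerates t P)
    (N₀ : ℕ) : NGeneratesFrom N₀ t P := by
  obtain ⟨c, ok, out, M, hM, hP, hex⟩ := h
  exact ⟨c, ok, out, M, hM, hP, fun x _ => hex x⟩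

/-- Monotonicity of `NGeneratesFrom` in the property and the threshold. [folklore] -/
theorem NGeneratesFrom.mono {N₀ N₁ : ℕ} {t : ℕ → ℕ} {P Q : List Bool → List Bool → Prop}
    (h : NGeneratesFrom N₀ t P) (hN : N₀ ≤ N₁) (hPQ : ∀ x z, P x z → Q x z) :
    NGeneratesFrom N₁ t Q := by
  obtain ⟨c, ok, out, M, hM, hP, hex⟩ := h
  exact ⟨c, ok, out, M, hM, fun x y hy => hPQ _ _ (hP x y hy), fun x hx => hex x (hN.trans hx)⟩

open TM2Comp in
/-- **Generation from `N₀` on by a prefix-reading machine behind a clock** (the `NGeneratesFrom`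
form of `MachineA.nGenerates_of_prefixMachine`): a clock printing `⟨x, 1^{s x}⟩` within `τ₁ x`
steps, a core machine printing `ok₀ x z :: out₀ x z` on `⟨x, z⟩`, `|z| ≤ s x`, within `τ₂ x` steps,
accepted outputs good, some short `z` accepted for every LONG `x`, and `τ₁ + τ₂ + s + |x| = O(t)`;
the machine `truncMapAux clock ▸ core` reads only the first `s x` guessed bits.
[cite: AroraBarakCC2009, §2.1 (verifiers and clocks)] -/
theorem MachineAQ.nGeneratesFrom_of_prefixMachine {N₀ : ℕ} {t : ℕ → ℕ}
    {P : List Bool → List Bool → Prop}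
    (s : List Bool → ℕ) (ok₀ : List Bool → List Bool → Bool) (out₀ : List Bool → List Bool → List Bool)
    (N M₀ : TM2ComputableAux Bool Bool) (τ₁ τ₂ : List Bool → ℕ)
    (hN : ∀ x, N.OutputsWithin x (boolPair x (List.replicate (s x) true)) (τ₁ x))
    (hM₀ : ∀ x z, z.length ≤ s x → M₀.OutputsWithin (boolPair x z) (ok₀ x z :: out₀ x z) (τ₂ x))
    (hsound : ∀ x z, z.length ≤ s x → ok₀ x z = true → P x (out₀ x z))
    (hcompl : ∀ x, N₀ ≤ x.length → ∃ z, z.length ≤ s x ∧ ok₀ x z = true)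
    (C : ℕ) (hτ : ∀ x, τ₁ x + τ₂ x + s x + x.length ≤ C * t x.length + C) :
    NGeneratesFrom N₀ t P := by
  refine ⟨5 * C + 11, fun x y => ok₀ x (y.take (s x)), fun x y => out₀ x (y.take (s x)),
    (truncMapAux N).comp M₀, fun x y => ?_, fun x y hy => ?_, fun x hx => ?_⟩
  · have h₁ := outputsWithin_truncMapAux_boolPair N (y := y) (hN x)
    simp only [List.length_replicate] at h₁
    have h₂ := hM₀ x (y.take (s x)) (List.length_take_le _ _)
    have h := TM2ComputableAux.comp_outputsWithin _ _ h₁ h₂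
    refine h.mono ?_
    have hτx := hτ x
    have hy2 : y.length / 2 ≤ y.length := Nat.div_le_self _ _
    set F := t x.length with hF
    have e2 : (5 * C + 11) * (F + y.length) = 5 * (C * F) + 11 * F + (5 * C + 11) * y.length := by ring
    have e3 : y.length ≤ (5 * C + 11) * y.length := Nat.le_mul_of_pos_left _ (by omega)
    omega
  · exact hsound x _ (List.length_take_le _ _) hy
  · obtain ⟨z, hz, hok⟩ := hcompl x hx
    refine ⟨z, ?_, by show ok₀ x (z.take (s x)) = true; rwa [List.take_of_length_le hz]⟩
    have hτx := hτ x
    have e2 : (5 * C + 11) * t x.length = 5 * (C * t x.length) + 11 * t x.length := by ring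
    omega

/-! ### The machine `A` at quasi-polynomial size -/

open MachineAQ MachineA SatCode Tableau GateList WitnessCheck MachineB TM2Comp CodeFP Brick in
/-- **Williams' generator `A` (Lemma 3.1) at QUASI-POLYNOMIAL size, on long inputs.** Let `cl` be a
succinct reduction of `L` with constant `c` (Fact 3.1), `m ≥ 2` a modulus, `r ≥ 2` a root; assume
QUASI-POLYNOMIAL-size depth-`d` `accBasis m`-circuits for `P`
(`P ⊆ ⋃ₐ DepthSizeClass (accBasis m) d (a · 2^{(log₂ n)^k} + a)`, assumption (A) of Murray–Williams
2018, proof of Thm. 1.2) and an `AC⁰[m]`-SAT algorithm for depth `d + 3` and `2^{⌊w^{1/r}⌋}` size in time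
`O(2^{w - ⌊w^{1/r}⌋})` (`AccSatSubexp (d + 3) m r`). Then for some constant `C_b` and threshold `N₀` the
clause circuits `C'ₓ` — `accBasis m`-circuits of depth `≤ d + 1` with at most
`C_b · 2^{⌊n^{1/(r+1)}⌋} + C_b` gates and fan-in computing the clause map of `cl x`
(`GoodClauseCircuitsB`) — are nondeterministically generated in time `O(n + 2ⁿ/n)`, with an accepted
guess on every input of length `≥ N₀` (`NGeneratesFrom N₀ williamsBound`; accepted printouts are good
on every input, short inputs are rejected). The machine is Williams' `A` (proof of Lemma 3.1, pp. 10–12: guess the circuits encoding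
the tableau of the clause-bit machine and `C'ₓ`, check them by ONE call of the SAT algorithm on
VALUE) as assembled in `Williams2014_lemma_3_1_of_stageA`, with: the size bound of the guessed
circuits `2^{P₀(size n)}` (`exists_goodFamiliesQ`; the stage function `exists_stageAQFn`); the
yardstick cutting the guess the root clock `⟨x, 1^{c' 2^{⌊n^{1/(r+1)}⌋} + c' + 1}⟩`
(`exists_rootClock_machine`), above the quasi-polynomial honest guess; the SAT call made only on
long inputs with an admissible guess, where VALUE — of quasi-polynomial size and fan-in at most the
yardstick — lies in the class `2^{⌊w^{1/r}⌋}` (`QPBdd.eventually_le_two_pow_nthRoot`,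
`eventually_poly_mul_two_pow_le_two_pow_nthRoot`), through the flag wrapper `flagAux`; every cost
`O(n + 2ⁿ/n)` (`exists_poly_rootClockLen_le_williamsBound`, `exists_satTimeSubexp_le`).
Murray–Williams, proof of Thm. 1.2: "by assumption (A) … has `C`-circuits of size
`2^{O(log^k n)}` … guess-and-verify". [cite: Williams2014, Lemma 3.1 (proof, pp. 10–12); MurrayWilliams2018, Thm. 1.2 (proof, §5)] -/
theorem MachineAQ.generatorQ (c : ℕ) {L : Language Bool} {cl : List Bool → ℕ → Clause ℕ}
    {m d k r : ℕ} (hred : IsSuccinctReduction c L cl) (hm : 2 ≤ m) (hr : 2 ≤ r)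
    (hP : Classes.P ⊆ ⋃ a : ℕ,
      DepthSizeClass (accBasis m) (fun _ => d) (fun n => a * 2 ^ Nat.log 2 n ^ k + a))
    (hsat : AccSatSubexp (d + 3) m r) :
    ∃ Cb N₀ : ℕ, NGeneratesFrom N₀ williamsBound (fun x z =>
      GoodClauseCircuitsB c cl m (d + 1) (Cb * 2 ^ Nat.nthRoot (r + 1) x.length + Cb) x z) := by
  have hm1 : 1 ≤ m := by omega
  have hr0 : r ≠ 0 := by omega
  have hr1 : r + 1 ≠ 0 := by omega
  -- the clause-bit machine and the good families of size `2^{P₀(size n)}`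
  obtain ⟨M, pT, hM⟩ := exists_bitMachine hred.polyTimeComputable
  obtain ⟨P₀, hgood⟩ := exists_goodFamiliesQ (M := M) (cl := cl) (by omega) hP hM c
  -- the yardstick `Y n = c' 2^{⌊n^{1/(r+1)}⌋} + c' + 1`, above the honest guess and above `S`
  have hgQ : QPBdd fun n => yard c m M pT (Polynomial.C (2 ^ P₀.eval (Nat.size n))) n + 2 ^ P₀.eval (Nat.size n) :=
    (qpBdd_yard c m M pT P₀).add (QPBdd.twoPow P₀)
  obtain ⟨Ny, hNy⟩ := hgQ.eventually_le_two_pow_nthRoot hr1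
  obtain ⟨Fy, hFym, hFy⟩ := hgQ.exists_mono_bound
  set c' : ℕ := Fy Ny + 1 with hc'
  set Y : ℕ → ℕ := rootClockLen (r + 1) c' with hY
  have hYeq : ∀ n, Y n = c' * 2 ^ Nat.nthRoot (r + 1) n + c' + 1 := fun n => rfl
  have hgY : ∀ n, yard c m M pT (Polynomial.C (2 ^ P₀.eval (Nat.size n))) n + 2 ^ P₀.eval (Nat.size n) ≤ Y n := by
    intro n
    rw [hYeq]
    rcases le_or_gt Ny n with hn | hn
    · calc yard c m M pT (Polynomial.C (2 ^ P₀.eval (Nat.size n))) n + 2 ^ P₀.eval (Nat.size n) ≤ 2 ^ Nat.nthRoot (r + 1) n := hNy n hn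
        _ ≤ c' * 2 ^ Nat.nthRoot (r + 1) n := Nat.le_mul_of_pos_left _ (by omega)
        _ ≤ _ := by omega
    · calc yard c m M pT (Polynomial.C (2 ^ P₀.eval (Nat.size n))) n + 2 ^ P₀.eval (Nat.size n) ≤ Fy n := hFy n
        _ ≤ Fy Ny := hFym hn.le
        _ ≤ _ := by omega
  have hYle : ∀ n, Y n ≤ (c' + 1) * 2 ^ Nat.nthRoot (r + 1) n + (c' + 1) := fun n => by
    rw [hYeq]; nlinarith [Nat.one_le_two_pow (n := Nat.nthRoot (r + 1) n)]
  -- the class threshold: VALUE is a `2^{⌊w^{1/r}⌋}`-size instance from `N₀` on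
  obtain ⟨N₁, hN₁⟩ := (qpBdd_sizeBd c M pT P₀).eventually_le_two_pow_nthRoot hr0
  obtain ⟨N₂, hN₂⟩ := (qpBdd_fanRest c m M pT P₀).eventually_le_two_pow_nthRoot hr1
  obtain ⟨N₃, hN₃⟩ := eventually_poly_mul_two_pow_le_two_pow_nthRoot (Polynomial.C (2 * c' + 2)) hr0
    (Nat.lt_succ_self r) 1
  obtain ⟨N₀, hN₀⟩ : ∃ N₀ : ℕ, N₀ = max N₁ (max N₂ N₃) := ⟨_, rfl⟩
  have hclass : ∀ n, N₀ ≤ n →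
      sizeBd c M pT (Polynomial.C (2 ^ P₀.eval (Nat.size n))) n ≤ 2 ^ Nat.nthRoot r (succinctWidth c n) ∧
      fanBd c m M pT (Polynomial.C (2 ^ P₀.eval (Nat.size n))) (Polynomial.C (Y n)) n ≤ 2 ^ Nat.nthRoot r (succinctWidth c n) := by
    intro n hn
    have hn1 : N₁ ≤ n := by omega
    have hn2 : N₂ ≤ n := by omega
    have hn3 : N₃ ≤ n := by omega
    have hmono : 2 ^ Nat.nthRoot r n ≤ 2 ^ Nat.nthRoot r (succinctWidth c n) :=
      Nat.pow_le_pow_right two_pos (PolyExistsNTIME.nthRoot_mono_right hr0 (le_succinctWidth c n))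
    refine ⟨(hN₁ n hn1).trans hmono, le_trans ?_ hmono⟩
    have hfan : fanBd c m M pT (Polynomial.C (2 ^ P₀.eval (Nat.size n))) (Polynomial.C (Y n)) n =
        Y n + (m * (succinctWidth c n + 2 ^ P₀.eval (Nat.size n)) + (cw M + 1) + termsLen c M pT n + 1) := by
      simp only [fanBd, eval_C]; ring
    rw [hfan]
    set ρ' := Nat.nthRoot (r + 1) n with hρ'
    have h2 := hN₂ n hn2
    have h3 := hN₃ n hn3
    simp only [eval_C] at h3
    have h1 : Y n ≤ (2 * c' + 1) * 2 ^ ρ' := by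
      rw [hYeq]; nlinarith [Nat.one_le_two_pow (n := ρ')]
    calc Y n + (m * (succinctWidth c n + 2 ^ P₀.eval (Nat.size n)) + (cw M + 1) + termsLen c M pT n + 1)
        ≤ (2 * c' + 1) * 2 ^ ρ' + 2 ^ ρ' := Nat.add_le_add h1 h2
      _ = (2 * c' + 2) * 2 ^ ρ' := by ring
      _ ≤ (2 * c' + 2) * 2 ^ (1 * ρ' + 1) :=
          Nat.mul_le_mul_left _ (Nat.pow_le_pow_right two_pos (by omega))
      _ ≤ 2 ^ Nat.nthRoot r n := h3
  -- the stage function (with the threshold), the formatter, the SAT machine, the root clock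
  obtain ⟨F, ⟨pF, MF, hMF⟩, hFst⟩ := exists_stageAQFn c m M pT (d + 1) P₀ N₀
  obtain ⟨MG, pG, hMG⟩ := exists_finMachine
  obtain ⟨cS, MS, hMS⟩ := (accSatSubexp_iff _ _ _).1 hsat
  obtain ⟨PC, KC, RC, hRC⟩ := exists_rootClock_machine hr1 c'
  -- abbreviations
  set D : (x z : List Bool) → Circuit (Fin (succinctWidth c x.length)) := fun x z =>
    dnfCircuit (blocksA c m M pT (d + 1) (Polynomial.C (2 ^ P₀.eval (Nat.size x.length))) x z)
      (termsA c M pT (d + 1) (Polynomial.C (2 ^ P₀.eval (Nat.size x.length))) x z) with hD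
  set okS : List Bool → List Bool → Bool := fun x z =>
    okA c M pT (d + 1) (Polynomial.C (2 ^ P₀.eval (Nat.size x.length))) x z with hokS
  set satBit : List Bool → List Bool → Bool := fun x z =>
    if N₀ ≤ x.length then (if okS x z then decide (D x z).Satisfiable else true) else true with hsatBit
  set ok₀ : List Bool → List Bool → Bool := fun x z => okS x z && !satBit x z with hok₀
  set out₀ : List Bool → List Bool → List Bool := fun x z =>
    listE (listE natE) (printA c m M pT (d + 1) (Polynomial.C (2 ^ P₀.eval (Nat.size x.length))) x z) with hout₀
  -- the class of the instance on long inputs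
  have hDclass : ∀ x z, z.length ≤ Y x.length → N₀ ≤ x.length →
      (D x z).IsOver (accBasis m) ∧ (D x z).acDepth ≤ d + 3 ∧
        (D x z).size ≤ 2 ^ Nat.nthRoot r (succinctWidth c x.length) ∧
        (D x z).maxFanIn ≤ 2 ^ Nat.nthRoot r (succinctWidth c x.length) := by
    intro x z hz hn
    have h := dnfCircuit_class (c := c) (m := m) (M := M) (pT := pT) (qE := Polynomial.C (2 ^ P₀.eval (Nat.size x.length)))
      (dE := d + 1) (yp := Polynomial.C (Y x.length)) x
      (blocksA c m M pT (d + 1) (Polynomial.C (2 ^ P₀.eval (Nat.size x.length))) x z) (φ := z.length)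
      (fun C hC => blocksA_class x z C hC) (by rw [eval_C]; exact hz.trans (Nat.le_add_right _ _)) ?_
      (termsA c M pT (d + 1) (Polynomial.C (2 ^ P₀.eval (Nat.size x.length))) x z) ?_
    · obtain ⟨h1, h2⟩ := hclass x.length hn
      exact ⟨h.1, h.2.1.trans (by omega), h.2.2.1.trans h1, h.2.2.2.trans h2⟩
    · by_cases hok : okA c M pT (d + 1) (Polynomial.C (2 ^ P₀.eval (Nat.size x.length))) x z = true
      · exact le_of_eq ((stageA_sound x z).2 hok).2.1
      · unfold blocksA; rw [if_neg hok]; exact Nat.zero_le _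
    · by_cases hok : okA c M pT (d + 1) (Polynomial.C (2 ^ P₀.eval (Nat.size x.length))) x z = true
      · exact Or.inl (by rw [termsA, if_pos hok])
      · exact Or.inr (by rw [termsA, if_neg hok])
  -- the SAT time and the output-length bound of stage `F`
  set tS : ℕ → ℕ := fun n =>
    cS * 2 ^ (succinctWidth c n - Nat.nthRoot r (succinctWidth c n)) + cS + 3 with htS
  set LF : ℕ → ℕ := fun n => 2 * n + 2 + Y n + machinePushBound MF.tm * pF.eval (2 * n + 2 + Y n)
    with hLF
  set τ₂ : List Bool → ℕ := fun x =>
    pF.eval (2 * x.length + 2 + Y x.length) +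
      ((pG.eval (4 + LF x.length)) + (tS x.length + 3 * 1 + 2 * LF x.length + 6)) with hτ₂
  -- the core machine
  have hcore : ∀ x z, z.length ≤ Y x.length →
      (MF.comp ((mapFstAux (flagAux MS fun b => [b])).comp MG)).OutputsWithin (boolPair x z)
        (ok₀ x z :: out₀ x z) (τ₂ x) := by
    intro x z hz
    have hsnd := stageA_sound (c := c) (m := m) (M := M) (pT := pT) (dE := d + 1)
      (qE := Polynomial.C (2 ^ P₀.eval (Nat.size x.length))) x z
    have hFa : F (boolPair x z) = boolPair (instQ N₀ x.length (okS x z) (circuitCodeList m (D x z)))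
        (boolPair [okS x z] (out₀ x z)) := by
      rw [hFst x z, packAQ, ← hsnd.1]
      rfl
    -- stage F
    have h1 : MF.OutputsWithin (boolPair x z) (F (boolPair x z)) (pF.eval (boolPair x z).length) := hMF _
    have hFm : pF.eval (boolPair x z).length ≤ pF.eval (2 * x.length + 2 + Y x.length) := by
      rw [length_boolPair]; exact natPoly_eval_mono pF (by omega)
    have hlenF : (F (boolPair x z)).length ≤ LF x.length := by
      have hl : (F (boolPair x z)).length ≤ (boolPair x z).length + machinePushBound MF.tm * pF.eval (boolPair x z).length :=
        h1.length_le
      have hmul := Nat.mul_le_mul_left (machinePushBound MF.tm) hFm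
      have hN₀ : (boolPair x z).length = 2 * x.length + 2 + z.length := length_boolPair _ _
      simp only [hLF]
      omega
    -- the SAT stage behind the flag wrapper and `mapFstAux`
    have hSAT : (flagAux MS fun b => [b]).OutputsWithin
        (instQ N₀ x.length (okS x z) (circuitCodeList m (D x z))) [satBit x z] (tS x.length) := by
      simp only [htS, hsatBit]
      rcases lt_or_ge x.length N₀ with hn | hn
      · rw [instQ_of_lt hn, if_neg (Nat.not_le.2 hn)]
        exact (flagAux_outputsWithin_answer MS (fun b => [b]) true).mono (by omega)
      · rw [if_pos hn]
        cases hok : okS x z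
        · rw [instQ_false]
          simp only [Bool.false_eq_true, ↓reduceIte]
          exact (flagAux_outputsWithin_answer MS (fun b => [b]) true).mono (by omega)
        · rw [instQ_of_le hn]
          simp only [↓reduceIte]
          obtain ⟨hO, hd', hs', hf'⟩ := hDclass x z hz hn
          have hS := hMS (succinctWidth c x.length) (D x z) hO hd' hs' hf'
          dsimp only at hS
          rw [encodeAccCircuit_eq_listE] at hS
          exact (flagAux_outputsWithin_run MS (fun b => [b]) hS).mono (by omega)
    have h2 := outputsWithin_mapFstAux (flagAux MS fun b => [b]) (z := F (boolPair x z))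
      (by rw [hFa, boolUnpair_boolPair]; exact hSAT)
    rw [hFa, readRest_boolPair] at h2
    rw [← hFa] at h2
    -- the formatter
    have h3 := hMG (boolPair [satBit x z] (boolPair [okS x z] (out₀ x z)))
    rw [finFun_apply] at h3
    have h23 := TM2ComputableAux.comp_outputsWithin _ _ h2 h3
    have h123 := TM2ComputableAux.comp_outputsWithin _ _ h1 h23
    refine (show ok₀ x z :: out₀ x z = _ from rfl) ▸ h123.mono ?_
    -- time
    have hrest : (boolPair [okS x z] (out₀ x z)).length ≤ (F (boolPair x z)).length := by
      rw [hFa]; simp only [length_boolPair]; omega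
    have hlen3 : (boolPair [satBit x z] (boolPair [okS x z] (out₀ x z))).length ≤ 4 + LF x.length := by
      have e : (boolPair [satBit x z] (boolPair [okS x z] (out₀ x z))).length =
          4 + (boolPair [okS x z] (out₀ x z)).length := by
        rw [length_boolPair]; simp
      omega
    have hG := natPoly_eval_mono pG hlen3
    simp only [hτ₂, List.length_singleton]
    omega
  -- every cost is `O(williamsBound n)`: all stage costs are polynomials of `Φ n = 2n + 2 + Y n`
  set Big : Polynomial ℕ := PC + Polynomial.C KC * X + pF +
    pG.comp (Polynomial.C 4 + X + Polynomial.C (machinePushBound MF.tm) * pF) +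
    Polynomial.C 2 * (X + Polynomial.C (machinePushBound MF.tm) * pF) + Polynomial.C 9 + X with hBig
  obtain ⟨K₁, hK₁⟩ := exists_poly_rootClockLen_le_williamsBound Big (r' := r + 1) (by omega) c' 2 2
  obtain ⟨KS, hKS⟩ := exists_satTimeSubexp_le c hr0
  have hτ : ∀ x : List Bool,
      (PC.eval x.length + KC * 2 ^ Nat.nthRoot (r + 1) x.length) + τ₂ x + Y x.length + x.length ≤
        (K₁ + cS * KS + cS + 3) * williamsBound x.length + (K₁ + cS * KS + cS + 3) := by
    intro x
    set n := x.length with hn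
    set Φ := 2 * n + 2 + Y n with hΦ
    have hnΦ : n ≤ Φ := by omega
    have hρΦ : 2 ^ Nat.nthRoot (r + 1) n ≤ Φ := by
      rw [hΦ, hYeq]
      have : 2 ^ Nat.nthRoot (r + 1) n ≤ c' * 2 ^ Nat.nthRoot (r + 1) n :=
        Nat.le_mul_of_pos_left _ (by omega)
      omega
    have hLFΦ : LF n = Φ + machinePushBound MF.tm * pF.eval Φ := by simp only [hLF, hΦ]
    have hBigΦ : PC.eval n + KC * 2 ^ Nat.nthRoot (r + 1) n + pF.eval Φ + pG.eval (4 + LF n) +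
        (3 * 1 + 2 * LF n + 6) + Y n + n ≤ Big.eval Φ := by
      have e1 : Big.eval Φ = PC.eval Φ + KC * Φ + pF.eval Φ +
          pG.eval (4 + Φ + machinePushBound MF.tm * pF.eval Φ) +
          2 * (Φ + machinePushBound MF.tm * pF.eval Φ) + 9 + Φ := by
        simp [hBig, eval_comp]
      rw [e1, hLFΦ]
      have a1 : PC.eval n ≤ PC.eval Φ := natPoly_eval_mono PC hnΦ
      have a2 : KC * 2 ^ Nat.nthRoot (r + 1) n ≤ KC * Φ := Nat.mul_le_mul_left KC hρΦ
      have a3 : pG.eval (4 + (Φ + machinePushBound MF.tm * pF.eval Φ)) =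
          pG.eval (4 + Φ + machinePushBound MF.tm * pF.eval Φ) := by
        congr 1; omega
      have a4 : Y n + n ≤ Φ := by omega
      omega
    have h1 : Big.eval Φ ≤ K₁ * williamsBound n + K₁ := by
      have := hK₁ n
      simpa only [hΦ, hY] using this
    have h2 := hKS n
    have h3 : tS n ≤ cS * (KS * williamsBound n + KS) + cS + 3 := by
      simp only [htS]
      have := Nat.mul_le_mul_left cS h2
      omega
    simp only [hτ₂]
    have e : (K₁ + cS * KS + cS + 3) * williamsBound n =
        K₁ * williamsBound n + cS * (KS * williamsBound n) + cS * williamsBound n + 3 * williamsBound n := by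
      ring
    nlinarith [hBigΦ, h1, h3, Nat.zero_le (williamsBound n)]
  -- the assembly
  refine ⟨c' + 1, N₀, nGeneratesFrom_of_prefixMachine (t := williamsBound)
    (fun x => Y x.length) ok₀ out₀ RC (MF.comp ((mapFstAux (flagAux MS fun b => [b])).comp MG))
    (fun x => PC.eval x.length + KC * 2 ^ Nat.nthRoot (r + 1) x.length) τ₂
    (fun x => hRC x) hcore ?_ ?_ (K₁ + cS * KS + cS + 3) hτ⟩
  · -- soundness
    intro x z hz hok
    have hokS : okS x z = true := by
      cases h : okS x z
      · simp [hok₀, h] at hok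
      · rfl
    have hn : N₀ ≤ x.length := by
      by_contra hn
      have : satBit x z = true := by simp only [hsatBit, if_neg hn]
      simp [hok₀, this] at hok
    have hunsatD : ¬ (D x z).Satisfiable := by
      intro hsat'
      have : satBit x z = true := by
        simp only [hsatBit, if_pos hn, hokS, if_true]
        exact decide_eq_true hsat'
      simp [hok₀, this] at hok
    obtain ⟨hterms, -, hprint⟩ := (stageA_sound (qE := Polynomial.C (2 ^ P₀.eval (Nat.size x.length))) x z).2 hokS
    have hunsat : ∀ u, dnfVal (blocksA c m M pT (d + 1) (Polynomial.C (2 ^ P₀.eval (Nat.size x.length))) x z) (allTerms M c pT x) u = false := by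
      intro u
      rw [← Bool.not_eq_true]
      intro hu
      apply hunsatD
      simp only [hD]
      rw [satisfiable_dnfCircuit_iff, hterms]
      exact ⟨u, hu⟩
    have hidx : ∀ κ : ClauseCoord (succinctWidth c x.length),
        outIdx c M pT x.length (coordPos κ) < (blocksA c m M pT (d + 1) (Polynomial.C (2 ^ P₀.eval (Nat.size x.length))) x z).length :=
      fun κ => (hprint (coordPos κ) (coordPos_lt κ)).1
    refine ⟨fun κ => (blocksA c m M pT (d + 1) (Polynomial.C (2 ^ P₀.eval (Nat.size x.length))) x z)[outIdx c M pT x.length (coordPos κ)]'(hidx κ),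
      fun κ => ?_, ?_⟩
    · obtain ⟨hO, hdp, hsz, hfan⟩ := blocksA_class x z _ (List.getElem_mem (hidx κ))
      rw [eval_C] at hsz
      have hSY : 2 ^ P₀.eval (Nat.size x.length) ≤ Y x.length := le_trans (Nat.le_add_left _ _) (hgY x.length)
      have hYb := hYle x.length
      refine ⟨hO, hdp, hsz.trans (hSY.trans hYb), hfan.trans (hz.trans hYb), fun i => ?_⟩
      have h := blockVal_out_eq_clauseMap hM c x (blocksA c m M pT (d + 1) (Polynomial.C (2 ^ P₀.eval (Nat.size x.length))) x z) hunsat κ i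
      rw [blockVal, dif_pos (hidx κ)] at h
      exact h
    · simp only [hout₀]
      rw [encodeAccCircuitList_eq_listE]
      congr 1
      apply List.ext_getElem?
      intro p
      by_cases hp : p < 3 * (succinctWidth c x.length + 2)
      · obtain ⟨h1, h2⟩ := hprint p hp
        have hp' : p < (clauseCoordList (succinctWidth c x.length)).length := by
          rw [length_clauseCoordList]; exact hp
        rw [h2, List.getElem?_map, List.getElem?_map, List.getElem?_eq_getElem hp']
        simp only [Option.map_some, Option.some.injEq]
        congr 2
        exact congrArg _ (coordPos_getElem_clauseCoordList p hp').symm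
      · rw [List.getElem?_eq_none (by rw [printA, List.length_map, List.length_range]; omega),
          List.getElem?_eq_none (by simp only [List.length_map, length_clauseCoordList]; omega)]
  · -- completeness on long inputs: the honest guess
    intro x hn
    · obtain ⟨E, hE, hval⟩ := hgood x
      set fams : List (List (Circuit (Fin (succinctWidth c x.length)))) :=
        (List.range (nFam c x.length)).map fun φ => (List.range (NVn c M pT x.length)).map (E φ) with hfams
      have hflat : fams.flatten = (List.range (nFam c x.length)).flatMap fun φ =>
          (List.range (NVn c M pT x.length)).map (E φ) := by
        rw [hfams, List.flatMap_def]
      have hlen : fams.length = nFam c x.length := by simp [hfams]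
      have hmemE : ∀ f ∈ fams, ∀ C ∈ f, ∃ φ r, C = E φ r := by
        intro f hf C hC
        rw [hfams] at hf
        obtain ⟨φ, -, rfl⟩ := List.mem_map.1 hf
        obtain ⟨r, -, rfl⟩ := List.mem_map.1 hC
        exact ⟨φ, r, rfl⟩
      have hfam : ∀ f ∈ fams, f.length = NVn c M pT x.length ∧
          ∀ C ∈ f, C.IsOver (accBasis m) ∧ C.acDepth ≤ d + 1 ∧ C.size ≤ (Polynomial.C (2 ^ P₀.eval (Nat.size x.length))).eval x.length := by
        intro f hf
        refine ⟨?_, fun C hC => ?_⟩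
        · rw [hfams] at hf
          obtain ⟨φ, -, rfl⟩ := List.mem_map.1 hf
          simp
        · obtain ⟨φ, r, rfl⟩ := hmemE f hf C hC
          exact ⟨(hE φ r).1, (hE φ r).2.1, by rw [eval_C]; exact (hE φ r).2.2.1⟩
      obtain ⟨hokz, hcodez⟩ := stageA_complete (c := c) (m := m) (M := M) (pT := pT) (dE := d + 1)
        (qE := Polynomial.C (2 ^ P₀.eval (Nat.size x.length))) x fams hlen hfam
      set z₀ := listE (listE (listE natE)) (fams.map fun f => f.map (circuitCodeList m)) with hz₀
      have hzlen : z₀.length ≤ Y x.length := by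
        refine le_trans ?_ (le_trans (Nat.le_add_right _ _) (hgY x.length))
        rw [yard_C]
        refine length_guess_le m fams hlen fun f hf => ⟨(hfam f hf).1, fun C hC => ?_⟩
        obtain ⟨φ, r, rfl⟩ := hmemE f hf C hC
        exact ⟨(hE φ r).2.2.1, (hE φ r).2.2.2⟩
      refine ⟨z₀, hzlen, ?_⟩
      have hokS : okS x z₀ = true := hokz
      have hDeq : D x z₀ = dnfCircuit fams.flatten (allTerms M c pT x) := by
        refine circuitCodeList_injOn m (succinctWidth c x.length) (hDclass x z₀ hzlen hn).1 ?_ ?_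
        · refine isOver_dnfCircuit _ _ fun C hC => ?_
          obtain ⟨f, hf, hCf⟩ := List.mem_flatten.1 hC
          exact ((hfam f hf).2 C hCf).1
        · show circuitCodeList m (D x z₀) = circuitCodeList m (dnfCircuit fams.flatten (allTerms M c pT x))
          rw [← hcodez]
          exact (stageA_sound x z₀).1.symm
      have hunsat : ¬ (D x z₀).Satisfiable := by
        rw [hDeq, satisfiable_dnfCircuit_iff, hflat]
        rintro ⟨u, hu⟩
        rw [hval u] at hu
        exact Bool.false_ne_true hu
      have hsb : satBit x z₀ = false := by
        simp only [hsatBit, if_pos hn, hokS, if_true]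
        exact decide_eq_false hunsat
      simp only [hok₀, hokS, hsb, Bool.not_false, Bool.and_self]

end Literature.Computability.Complexity
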